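/-
Copyright (c) 2026. All rights reserved.
Released under Apache 2.0 license as described in the file LICENSE.
Authors: abc-iut cell, cone prover seat abc-iut-w6-d032 (wave W6, block C).
-/
import Literature.AnabelianGeometry.EtaleTheta.ThetaCoversOfType
import Literature.AnabelianGeometry.EtaleTheta.ThetaCoversHeisenbergWitnessProp22

/-!
# [EtTh] Definitions 2.1 / 2.3 — the four "of type" predicates: universal closures REFUTED, instance
# forms PROVED in the Heisenberg toy (kernel bookkeeping for FACT-LIST rows F-0592 – F-0595)

Mochizuki, *The Étale Theta Function and its Frobenioid-theoretic Manifestations* [EtTh], Publ. RIMS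
45 (2009), §2, Definition 2.1 (PRIMS p.36), Definition 2.3 (p.38), bib key `MochizukiEtTh2009`.

The predicates `CoverData.OfTypeLTors` / `OfTypeLTorsPm` / `OfTypeLTorsTheta` / `OfTypeLTorsThetaPm`
(abc-iut-L2-t2, `ThetaCovers.lean` p405102) are print's VOCABULARY "a smooth log orbicurve … of type
`(1, l-tors)` / `(1, l-tors)±` / `(1, l-torsΘ)` / `(1, l-torsΘ)±`" (Def 2.1 / 2.3: "arises, up to
isomorphism, as `X̲` / `C̲` / `X̲̲` / `C̲̲`"), i.e. DEFINITIONS, not assertions.  The abc-iut cell's frozen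
FACT-LIST carries them as rows F-0592 – F-0595 (kernel_closedness `parametrised`); this PROOF-ONLY file
records the two kernel events that settle such schema rows:

* **universal closure REFUTED** (`not_forall_ofTypeLTors`, `not_forall_ofTypeLTorsPm`,
  `not_forall_ofTypeLTorsTheta`, `not_forall_ofTypeLTorsThetaPm`): "every subgroup of `Π_C` is of type …"
  is false — by the degenerate-argument exclusions of `ThetaCoversOfType.lean` (`Π_C` is of no type
  `(1, l-tors)` / `(1, l-torsΘ)`, the trivial subgroup of no type `(1, l-tors)±` / `(1, l-torsΘ)±`, for
  EVERY `CoverData`), instantiated at abc-iut-w5-d243's kernel inhabitant of the interface, the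
  Heisenberg toy `heisenbergWitness 3` (`Π_C = (ℤ/3 × ℤ/3) ⋊ D_3`);
* **instance forms PROVED** (`ofTypeLTors_toy`, `ofTypeLTorsPm_toy`, `ofTypeLTorsTheta_toy`,
  `ofTypeLTorsThetaPm_toy`): for every odd `l`, the toy's `Π_X̲ = (ℤ/l)² ⋊ 1`, `Π_C̲ = (ℤ/l)² ⋊ {1, s}`,
  `Π_X̲̲ = S · E = 1 · ({(b, 0)} ⋊ 1)`, `Π_C̲̲ = ⟨Π_X̲̲, s⟩` ARE of type `(1, l-tors)`, `(1, l-tors)±`,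
  `(1, l-torsΘ)`, `(1, l-torsΘ)±` respectively (from `ThetaCoversHeisenbergWitnessProp22.lean`'s
  `isTypeLTors_inf`, `isTypeLTorsPm_heisPiCu`, `isInversion_s`, `isMinusEigen_heisE`, `isSplitting_bot`,
  `s_mul_s_mem`), so the four notions are non-vacuous over the typed interface.

CONSISTENCY/VOCABULARY BOOKKEEPING ONLY — the toy is a consistency witness, not a model of print
(there `Δ_X` is free profinite of rank `2`, `G_K = Gal(K̄/K)`); nothing here takes a side on anything
printed.  No definitions, no `sorry`.
-/

namespace Literature.AnabelianGeometry.EtaleTheta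

namespace ThetaCovers

namespace HeisenbergWitness

variable (l : ℕ) (hl : Odd l)

/-! ## Instance forms: the toy's four coverings are of their types -/

/-- **Def 2.1 at the toy**: `Π_X̲ = Π_C̲ ∩ Π_X = (ℤ/l)² ⋊ 1` is of type `(1, l-tors)`.
(toy bookkeeping for the typed vocabulary of [EtTh] Def 2.1; no claim about print)
[cite: MochizukiEtTh2009, Def 2.1 p.36] -/
theorem ofTypeLTors_toy :
    (heisenbergWitness l hl).toCoverData.OfTypeLTors (heisPiCu l ⊓ heisPiX l) :=
  (isTypeLTors_inf l hl).ofTypeLTors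

/-- **Def 2.1 at the toy**: `Π_C̲ = (ℤ/l)² ⋊ {1, s}` is of type `(1, l-tors)±`.
(toy bookkeeping for the typed vocabulary of [EtTh] Def 2.1; no claim about print)
[cite: MochizukiEtTh2009, Def 2.1 p.36] -/
theorem ofTypeLTorsPm_toy : (heisenbergWitness l hl).toCoverData.OfTypeLTorsPm (heisPiCu l) :=
  (isTypeLTorsPm_heisPiCu l hl).ofTypeLTorsPm

/-- **Def 2.3 at the toy**: `Π_X̲̲ = S · E` with `S = 1`, `E = {(b, 0)} ⋊ 1` is of type `(1, l-torsΘ)`.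
(toy bookkeeping for the typed vocabulary of [EtTh] Def 2.3; no claim about print)
[cite: MochizukiEtTh2009, Def 2.3 p.38] -/
theorem ofTypeLTorsTheta_toy :
    (heisenbergWitness l hl).toCoverData.OfTypeLTorsTheta (⊥ ⊔ heisE l) :=
  CoverData.ofTypeLTorsTheta_of_data (isTypeLTorsPm_heisPiCu l hl) (isInversion_s l hl)
    (isMinusEigen_heisE l hl) (isSplitting_bot l hl)

/-- **Def 2.3 at the toy**: `Π_C̲̲ = ⟨Π_X̲̲, s⟩` (the reflection `s` has order `2`) is of type
`(1, l-torsΘ)±`. (toy bookkeeping for the typed vocabulary of [EtTh] Def 2.3; no claim about print)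
[cite: MochizukiEtTh2009, Def 2.3 p.38] -/
theorem ofTypeLTorsThetaPm_toy :
    (heisenbergWitness l hl).toCoverData.OfTypeLTorsThetaPm
      ((⊥ ⊔ heisE l) ⊔ Subgroup.zpowers (SemidirectProduct.inr (DihedralGroup.sr 0))) :=
  CoverData.ofTypeLTorsThetaPm_of_data (isTypeLTorsPm_heisPiCu l hl) (isInversion_s l hl)
    (s_mul_s_mem l hl) (isMinusEigen_heisE l hl) (isSplitting_bot l hl)

/-! ## Universal closures refuted -/

/-- `3` is odd (the toy used for the refutations is `heisenbergWitness 3`).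
(bookkeeping) [cite: MochizukiEtTh2009, Def 2.1 p.36] -/
theorem odd_three : Odd 3 := ⟨1, rfl⟩

/-- **F-0592, universal closure REFUTED**: it is false that every subgroup of every `Π_C` is of type
`(1, l-tors)` — `Π_C` itself never is (`CoverData.not_ofTypeLTors_top`), e.g. in the Heisenberg toy at
`l = 3`. The decl is Def 2.1's vocabulary, not a claim. [cite: MochizukiEtTh2009, Def 2.1 p.36] -/
theorem not_forall_ofTypeLTors :
    ¬ ∀ (l : ℕ) (X : CoverData.{0} l) (H : Subgroup X.PiC), X.OfTypeLTors H :=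
  fun h => CoverData.not_ofTypeLTors_top (h 3 (heisenbergWitness 3 odd_three).toCoverData ⊤)

/-- **F-0593, universal closure REFUTED**: it is false that every subgroup of every `Π_C` is of type
`(1, l-tors)±` — the trivial subgroup never is (`CoverData.not_ofTypeLTorsPm_bot`), e.g. in the
Heisenberg toy at `l = 3`. The decl is Def 2.1's vocabulary, not a claim.
[cite: MochizukiEtTh2009, Def 2.1 p.36] -/
theorem not_forall_ofTypeLTorsPm :
    ¬ ∀ (l : ℕ) (X : CoverData.{0} l) (H' : Subgroup X.PiC), X.OfTypeLTorsPm H' :=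
  fun h => CoverData.not_ofTypeLTorsPm_bot (h 3 (heisenbergWitness 3 odd_three).toCoverData ⊥)

/-- **F-0594, universal closure REFUTED**: it is false that every subgroup of every `Π_C` is of type
`(1, l-torsΘ)` — `Π_C` itself never is (`CoverData.not_ofTypeLTorsTheta_top`), e.g. in the Heisenberg
toy at `l = 3`. The decl is Def 2.3's vocabulary, not a claim. [cite: MochizukiEtTh2009, Def 2.3 p.38] -/
theorem not_forall_ofTypeLTorsTheta :
    ¬ ∀ (l : ℕ) (X : CoverData.{0} l) (H2 : Subgroup X.PiC), X.OfTypeLTorsTheta H2 :=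
  fun h => CoverData.not_ofTypeLTorsTheta_top (h 3 (heisenbergWitness 3 odd_three).toCoverData ⊤)

/-- **F-0595, universal closure REFUTED**: it is false that every subgroup of every `Π_C` is of type
`(1, l-torsΘ)±` — the trivial subgroup never is (`CoverData.not_ofTypeLTorsThetaPm_bot`), e.g. in the
Heisenberg toy at `l = 3`. The decl is Def 2.3's vocabulary, not a claim.
[cite: MochizukiEtTh2009, Def 2.3 p.38] -/
theorem not_forall_ofTypeLTorsThetaPm :
    ¬ ∀ (l : ℕ) (X : CoverData.{0} l) (H2' : Subgroup X.PiC), X.OfTypeLTorsThetaPm H2' :=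
  fun h => CoverData.not_ofTypeLTorsThetaPm_bot (h 3 (heisenbergWitness 3 odd_three).toCoverData ⊥)

/-- The four refutations at once, at a SINGLE inhabitant and per `X` (the form closest to the FACT-LIST
reading "the predicate holds of every subgroup of the given `Π_C`"): in the Heisenberg toy (any odd `l`)
none of the four predicates holds of every subgroup. [cite: MochizukiEtTh2009, Def 2.1 p.36] -/
theorem not_forall_ofType_toy :
    (¬ ∀ H : Subgroup (heisPiC l), (heisenbergWitness l hl).toCoverData.OfTypeLTors H) ∧
    (¬ ∀ H' : Subgroup (heisPiC l), (heisenbergWitness l hl).toCoverData.OfTypeLTorsPm H') ∧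
    (¬ ∀ H2 : Subgroup (heisPiC l), (heisenbergWitness l hl).toCoverData.OfTypeLTorsTheta H2) ∧
    (¬ ∀ H2' : Subgroup (heisPiC l), (heisenbergWitness l hl).toCoverData.OfTypeLTorsThetaPm H2') :=
  ⟨fun h => CoverData.not_ofTypeLTors_top (h ⊤), fun h => CoverData.not_ofTypeLTorsPm_bot (h ⊥),
    fun h => CoverData.not_ofTypeLTorsTheta_top (h ⊤), fun h => CoverData.not_ofTypeLTorsThetaPm_bot (h ⊥)⟩

end HeisenbergWitness

end ThetaCovers

end Literature.AnabelianGeometry.EtaleTheta
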